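import Summits.CriticalPhenomena.PercolationContinuityZ3.Theorems.SahiMasterFamilyPhiCert
import Literature.Combinatorics.Sahi2008.Symmetry

/-!
# A KERNEL-checkable certificate format for `F(n)` (`PhiNonneg n`), part 3: the orbit basis

Unit `prim-masterthm-p4` (gen 13; crux anchor stmt-CriticalPhenomena-4575, helper work; memo
`run/shared/lean/prim/prim-masterthm/prim-masterthm-p4/P4-GEN13-REPORT.md` §9).  Continues `…PhiCertPoly` / `…PhiCert`.

The symmetrised certificates `Φ_n = (1/n!) Σ_{g∈S_n} Σ_t c_t g·∏atoms_t` are small BEFORE symmetrisation (n = 7: 50 terms, 433 monomials)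
but huge after it (22 050 products, 321 006 monomial incidences) — too much for the kernel's evaluator (`…PhiCertSeven` resorts to compiled
evaluation).  Here the symmetrisation is done SYMBOLICALLY: for the relabelled valuation `actV σ β (S) = β(σ(S))`,
* `phiSet_actV`: `Φ_n(actV σ β) = Φ_n(β)` (symmetry of `E_n`, `sahiE_comp_perm`, in the canonical signed model), so `n!·Φ_n(β) = Σ_σ Φ_n(actV σ β)`;
* `evalSym β p := Σ_σ evalP (val (actV σ β)) p = Σ_{(μ,c)∈p} c·M_μ(β)` with the ORBIT SUMS `M_μ(β) = Σ_σ ∏_{S∈μ} β(σ(S))` (`Msum`), and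
  `Msum_relabel`: `M_{g·κ} = M_κ` for a permutation `g` given as a checked list (`isPermList`, `imgMask`, `ofMask_imgMask`);
* hence the identity `Σ_σ (Q − M·Φ_n)(actV σ β) = 0` (Q the unsymmetrised certificate) follows from a FINITE check on small data
  (`verifyOrbit`): the polynomial `R = Q − M·Φ_n` (computed in the syntax of part 1/2, `termsPoly`/`symE`) coincides with a supplied list of
  (coefficient, permutation, canonical monomial) triples after relabelling, and the relabelled list has all orbit-class sums zero;
* `phiNonneg_of_verifyOrbit : verifyOrbit (n+1) M C D = true → 0 < M → PhiNonneg (n+1)`, the positivity coming from `Q(actV σ β) ≥ 0`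
  termwise (`termsPoly_nonneg`).
For `n = 7` the data `D` has 1 284 entries in 75 orbit classes and the whole check is a `decide` the kernel performs (sorting ≈ 6 000 entries),
so `F(7)` becomes a kernel theorem with standard axioms (`…PhiOrbitSeven`).  HONEST FRAMING: infrastructure.  Axioms standard. [this work]
-/

set_option autoImplicit false

namespace Summit.CriticalPhenomena.PercolationContinuityZ3.Theorems

namespace PhiCert

open Finset Literature.Combinatorics.Sahi2008
open PrincipalCapBeta (realF realW)

/-! ## Relabelled valuations and the symmetry of `Φ_n` -/

section Action

variable {n : ℕ}

/-- The relabelled valuation `S ↦ β(σ(S))`. [this work] -/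
noncomputable def actV (σ : Equiv.Perm (Fin n)) (β : Finset (Fin n) → ℝ) : Finset (Fin n) → ℝ :=
  fun S => β (S.map σ.toEmbedding)

/-- Relabelling fixes the top. [this work] -/
theorem actV_univ (σ : Equiv.Perm (Fin n)) (β : Finset (Fin n) → ℝ) : actV σ β univ = β univ := by
  unfold actV
  rw [Finset.map_univ_equiv]

/-- Relabelling preserves supermultiplicativity. [this work] -/
theorem actV_supermul (σ : Equiv.Perm (Fin n)) (β : Finset (Fin n) → ℝ) (hsup : ∀ S T, β S * β T ≤ β (S ∪ T))
    (S T : Finset (Fin n)) : actV σ β S * actV σ β T ≤ actV σ β (S ∪ T) := by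
  unfold actV
  rw [Finset.map_union]
  exact hsup _ _

/-- **Symmetry of `Φ`**: `Φ_{n+1}(actV σ β) = Φ_{n+1}(β)` (from `sahiE_comp_perm` in the canonical signed model). [this work] -/
theorem phiSet_actV (σ : Equiv.Perm (Fin (n + 1))) (β : Finset (Fin (n + 1)) → ℝ) :
    PrincipalCapBeta.phiSet (n + 1) (actV σ β) = PrincipalCapBeta.phiSet (n + 1) β := by
  have h1 : sahiE (realW β) (n + 1) (fun i => realF (σ i)) = sahiE (realW β) (n + 1) realF :=
    sahiE_comp_perm (realW β) (n + 1) σ realF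
  rw [PrincipalCapBeta.phiSet_eq_sahiE_real β, ← h1, PrincipalCapBeta.sahiE_eq_phiSet]
  congr 1
  funext B
  show β (B.map σ.toEmbedding) = ex (realW β) (∏ x ∈ B, (realF (σ x) : Finset (Fin (n + 1)) → ℝ))
  have e : (∏ x ∈ B, (realF (σ x) : Finset (Fin (n + 1)) → ℝ)) = ∏ y ∈ B.map σ.toEmbedding, realF y := by
    rw [prod_map]; rfl
  rw [e, PrincipalCapBeta.ex_realW_prod]

/-- The symmetrised evaluation `Σ_σ p(actV σ β)`. [this work] -/
noncomputable def evalSym (β : Finset (Fin n) → ℝ) (p : Poly) : ℝ :=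
  ∑ σ : Equiv.Perm (Fin n), evalP (val (actV σ β)) p

/-- The orbit sum of a monomial: `M_μ(β) = Σ_σ ∏_{S∈μ} β(σ(S))`. [this work] -/
noncomputable def Msum (β : Finset (Fin n) → ℝ) (μ : Mono) : ℝ :=
  ∑ σ : Equiv.Perm (Fin n), evalM (val (actV σ β)) μ

/-- `evalSym` in the orbit-sum basis. [this work] -/
theorem evalSym_eq (β : Finset (Fin n) → ℝ) : ∀ p : Poly, evalSym β p = (p.map fun x => (x.2 : ℝ) * Msum β x.1).sum
  | [] => by simp [evalSym, evalP]
  | x :: p => by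
    have ih := evalSym_eq β p
    unfold evalSym at ih ⊢
    rw [List.map_cons, List.sum_cons, ← ih]
    unfold Msum
    rw [Finset.mul_sum, ← Finset.sum_add_distrib]
    rfl

/-- `evalSym` is additive. [this work] -/
theorem evalSym_append (β : Finset (Fin n) → ℝ) (p q : Poly) : evalSym β (p ++ q) = evalSym β p + evalSym β q := by
  unfold evalSym
  rw [← Finset.sum_add_distrib]
  exact Finset.sum_congr rfl fun σ _ => evalP_append _ _ _

/-- `evalSym` respects the normal form. [this work] -/
theorem evalSym_normP (β : Finset (Fin n) → ℝ) (p : Poly) : evalSym β (normP p) = evalSym β p := by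
  unfold evalSym
  exact Finset.sum_congr rfl fun σ _ => evalP_normP _ _

end Action


/-! ## Normalising variants of the symbolic recursion and of the certificate polynomial (smaller kernel work) -/

/-- `symE` with the normal form taken at every level of the recursion. [this work] -/
def symEN (n : ℕ) : (m : ℕ) → (Fin m → ℕ) → Poly
  | 0, _ => []
  | 1, L => mono n (L 0)
  | m + 2, L =>
      normP ((List.finRange (m + 1)).foldr
          (fun i acc => symEN n (m + 1) (Function.update (Fin.tail L) i (Fin.tail L i ||| L 0)) ++ acc) []
        ++ scaleP (-1) (mulP (symEN n (m + 1) (Fin.tail L)) (mono n (L 0))))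

/-- `symEN` evaluates like `symE`. [this work] -/
theorem evalP_symEN {n : ℕ} (β : Finset (Fin n) → ℝ) (huniv : β univ = 1) :
    ∀ (m : ℕ) (L : Fin m → ℕ), evalP (val β) (symEN n m L) = evalP (val β) (symE n m L)
  | 0, L => rfl
  | 1, L => rfl
  | m + 2, L => by
    rw [symEN, symE, evalP_normP, evalP_append, evalP_append, evalP_foldr, evalP_foldr, evalP_scaleP, evalP_scaleP,
      evalP_mulP, evalP_mulP, evalP_symEN β huniv (m + 1)]
    congr 2
    exact List.map_congr_left fun i _ => evalP_symEN β huniv (m + 1) _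

/-- `symEN` of the singleton masks is `Φ_n`. [this work] -/
theorem evalP_symEN_singletons {n : ℕ} (β : Finset (Fin (n + 1)) → ℝ) (huniv : β univ = 1) :
    evalP (val β) (symEN (n + 1) (n + 1) fun i => 2 ^ (i : ℕ)) = PrincipalCapBeta.phiSet (n + 1) β := by
  rw [evalP_symEN β huniv, evalP_symE_singletons β huniv]

/-- `termsPoly` with each product normalised. [this work] -/
def termsPolyN (n : ℕ) : List (ℤ × List Atom) → Poly
  | [] => []
  | t :: T => normP (scaleP t.1 (prodP n t.2)) ++ termsPolyN n T

/-- `termsPolyN` evaluates like `termsPoly`. [this work] -/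
theorem evalP_termsPolyN {n : ℕ} (v : ℕ → ℝ) : ∀ T : List (ℤ × List Atom), evalP v (termsPolyN n T) = evalP v (termsPoly n T)
  | [] => rfl
  | t :: T => by rw [termsPolyN, termsPoly, evalP_append, evalP_append, evalP_normP, evalP_termsPolyN v T]

/-! ## Permutations as checked lists; images of bitmasks -/

/-- `g` lists a permutation of `{0,…,n−1}`. [this work] -/
def isPermList (n : ℕ) (g : List ℕ) : Bool :=
  (g.length == n) && (g.all fun x => decide (x < n)) && ((List.range n).all fun j => g.any fun x => x == j)

/-- Image of a bitmask under `i ↦ g[i]`, accumulated over a list of positions. [this work] -/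
def imgMaskL (g : List ℕ) (S : ℕ) : List ℕ → ℕ
  | [] => 0
  | i :: is => (if S.testBit i then 2 ^ (g.getD i 0) else 0) ||| imgMaskL g S is

/-- Image of a bitmask under `i ↦ g[i]` (`i < n`). [this work] -/
def imgMask (n : ℕ) (g : List ℕ) (S : ℕ) : ℕ := imgMaskL g S (List.range n)

/-- Bits of the image. [this work] -/
theorem testBit_imgMaskL (g : List ℕ) (S : ℕ) : ∀ (is : List ℕ) (y : ℕ),
    (imgMaskL g S is).testBit y = true ↔ ∃ i ∈ is, S.testBit i = true ∧ g.getD i 0 = y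
  | [], y => by simp [imgMaskL]
  | i :: is, y => by
    rw [imgMaskL, Nat.testBit_lor, Bool.or_eq_true, testBit_imgMaskL g S is y]
    constructor
    · rintro (h | ⟨j, hj, h1, h2⟩)
      · by_cases hS : S.testBit i = true
        · rw [if_pos hS, Nat.testBit_two_pow, decide_eq_true_eq] at h
          exact ⟨i, List.mem_cons_self, hS, h⟩
        · rw [if_neg hS, Nat.zero_testBit] at h
          exact absurd h Bool.false_ne_true
      · exact ⟨j, List.mem_cons_of_mem _ hj, h1, h2⟩
    · rintro ⟨j, hj, h1, h2⟩
      rcases List.mem_cons.1 hj with rfl | hj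
      · left
        rw [if_pos h1, Nat.testBit_two_pow, decide_eq_true_eq]
        exact h2
      · right
        exact ⟨j, hj, h1, h2⟩

/-- A checked list is a permutation of `Fin n`. [this work] -/
theorem exists_perm_of_isPermList {n : ℕ} {g : List ℕ} (h : isPermList n g = true) :
    ∃ σ : Equiv.Perm (Fin n), ∀ i : Fin n, ((σ i : Fin n) : ℕ) = g.getD i 0 := by
  simp only [isPermList, Bool.and_eq_true, beq_iff_eq, List.all_eq_true, decide_eq_true_eq, List.any_eq_true] at h
  obtain ⟨⟨hlen, hlt⟩, hsurj⟩ := h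
  have hget : ∀ (i : ℕ) (hi : i < g.length), g.getD i 0 = g[i] := fun i hi => by
    rw [List.getD_eq_getElem?_getD, List.getElem?_eq_getElem hi, Option.getD_some]
  have hlt' : ∀ i : Fin n, g.getD i 0 < n := fun i => by
    have hi : (i : ℕ) < g.length := hlen ▸ i.isLt
    rw [hget _ hi]
    exact hlt _ (List.getElem_mem hi)
  let f : Fin n → Fin n := fun i => ⟨g.getD i 0, hlt' i⟩
  have hs : Function.Surjective f := by
    intro j
    obtain ⟨x, hx, hxj⟩ := hsurj j (List.mem_range.2 j.isLt)
    obtain ⟨m, hm, rfl⟩ := List.getElem_of_mem hx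
    refine ⟨⟨m, hlen ▸ hm⟩, Fin.ext ?_⟩
    show g.getD m 0 = j
    rw [hget _ hm]
    exact hxj
  exact ⟨Equiv.ofBijective f ⟨Finite.injective_iff_surjective.2 hs, hs⟩, fun i => rfl⟩

/-- **Images of masks are images of sets**: `ofMask (imgMask g S) = σ(ofMask S)`. [this work] -/
theorem ofMask_imgMask {n : ℕ} {g : List ℕ} (σ : Equiv.Perm (Fin n)) (hσ : ∀ i : Fin n, ((σ i : Fin n) : ℕ) = g.getD i 0)
    (S : ℕ) : ofMask n (imgMask n g S) = (ofMask n S).map σ.toEmbedding := by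
  ext y
  rw [mem_map]
  simp only [ofMask, mem_filter, mem_univ, true_and, imgMask]
  rw [testBit_imgMaskL]
  constructor
  · rintro ⟨i, hi, hS, hgy⟩
    have hin : i < n := List.mem_range.1 hi
    refine ⟨⟨i, hin⟩, hS, Fin.ext ?_⟩
    show ((σ ⟨i, hin⟩ : Fin n) : ℕ) = y
    rw [hσ]
    exact hgy
  · rintro ⟨a, hS, hay⟩
    refine ⟨a, List.mem_range.2 a.isLt, hS, ?_⟩
    rw [← hσ a]
    exact congrArg Fin.val hay

/-! ## Orbit sums are invariant under relabelling -/

section Relabel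

variable {n : ℕ}

/-- `evalM` as a list product. [this work] -/
theorem evalM_eq_prod (v : ℕ → ℝ) : ∀ m : Mono, evalM v m = (m.map v).prod
  | [] => rfl
  | a :: m => by rw [evalM, evalM_eq_prod v m, List.map_cons, List.prod_cons]

/-- Merging preserves multiplicative valuations. [this work] -/
theorem prod_mergeBy {α : Type} (le : α → α → Bool) (g : α → ℝ) :
    ∀ (f : ℕ) (l₁ l₂ : List α), ((mergeBy le f l₁ l₂).map g).prod = (l₁.map g).prod * (l₂.map g).prod
  | 0, l₁, l₂ => by rw [mergeBy, List.map_append, List.prod_append]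
  | f + 1, [], l₂ => by rw [mergeBy, List.map_nil, List.prod_nil, one_mul]
  | f + 1, a :: l₁, [] => by rw [mergeBy, List.map_nil, List.prod_nil, mul_one]
  | f + 1, a :: l₁, b :: l₂ => by
    rw [mergeBy]
    split_ifs
    · simp only [List.map_cons, List.prod_cons, prod_mergeBy le g f l₁ (b :: l₂)]; ring
    · simp only [List.map_cons, List.prod_cons, prod_mergeBy le g f (a :: l₁) l₂]; ring

/-- Sorting preserves multiplicative valuations. [this work] -/
theorem prod_msortBy {α : Type} (le : α → α → Bool) (g : α → ℝ) :
    ∀ (f : ℕ) (l : List α), ((msortBy le f l).map g).prod = (l.map g).prod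
  | 0, l => by rw [msortBy]
  | f + 1, l => by
    rw [msortBy]
    split_ifs
    · rfl
    · rw [prod_mergeBy, prod_msortBy le g f, prod_msortBy le g f, ← List.prod_append, ← List.map_append,
        List.take_append_drop]

/-- Sorting a monomial does not change its value. [this work] -/
theorem evalM_msortBy (v : ℕ → ℝ) (le : ℕ → ℕ → Bool) (f : ℕ) (m : Mono) :
    evalM v (msortBy le f m) = evalM v m := by
  rw [evalM_eq_prod, evalM_eq_prod, prod_msortBy]

/-- The image monomial under `τ` is the original monomial under `σ.trans τ`. [this work] -/
theorem evalM_map_imgMask {g : List ℕ} (σ : Equiv.Perm (Fin n)) (hσ : ∀ i : Fin n, ((σ i : Fin n) : ℕ) = g.getD i 0)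
    (β : Finset (Fin n) → ℝ) (τ : Equiv.Perm (Fin n)) :
    ∀ κ : Mono, evalM (val (actV τ β)) (κ.map (imgMask n g)) = evalM (val (actV (σ.trans τ) β)) κ
  | [] => rfl
  | S :: κ => by
    rw [List.map_cons, evalM, evalM, evalM_map_imgMask σ hσ β τ κ]
    congr 1
    show β ((ofMask n (imgMask n g S)).map τ.toEmbedding) = β ((ofMask n S).map (σ.trans τ).toEmbedding)
    rw [ofMask_imgMask σ hσ, Finset.map_map]
    rfl

/-- **Orbit sums are class functions**: `M_{g·κ} = M_κ`. [this work] -/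
theorem Msum_relabel {g : List ℕ} (hg : isPermList n g = true) (β : Finset (Fin n) → ℝ) (κ : Mono) (f : ℕ) :
    Msum β (msortBy (fun a b => Nat.ble a b) f (κ.map (imgMask n g))) = Msum β κ := by
  obtain ⟨σ, hσ⟩ := exists_perm_of_isPermList hg
  unfold Msum
  simp only [evalM_msortBy, evalM_map_imgMask σ hσ β]
  exact Fintype.sum_equiv (Equiv.mulRight σ) _ _ fun τ => rfl

end Relabel


/-! ## Compact encodings of the data (decoded by the kernel; no soundness needed) -/

/-- `len` base-`b` digits of `x`, least significant first. [this work] -/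
def digitsFix (b : ℕ) : ℕ → ℕ → List ℕ
  | 0, _ => []
  | len + 1, x => (x % b) :: digitsFix b len (x / b)

/-- Base-`b` digits of `x` until it vanishes (at most `fuel`), least significant first. [this work] -/
def digitsVar (b : ℕ) : ℕ → ℕ → List ℕ
  | 0, _ => []
  | fuel + 1, x => if x = 0 then [] else (x % b) :: digitsVar b fuel (x / b)

/-- Decode an orbit-data entry `(c, g as 3-bit digits, κ as 7-bit digits)`. [this work] -/
def decodeD (n : ℕ) (e : ℤ × ℕ × ℕ) : ℤ × List ℕ × Mono :=
  (e.1, digitsFix 8 n e.2.1, digitsVar 128 n e.2.2)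

/-- Decode a normal-form entry `(μ as 7-bit digits, c)`. [this work] -/
def decodeR (n : ℕ) (e : ℕ × ℤ) : Mono × ℤ :=
  (digitsVar 128 n e.1, e.2)

/-! ## The orbit-basis check and its soundness -/

/-- Reconstruct `(g·κ, c)` from a data entry `(c, g, κ)`. [this work] -/
def recon (n : ℕ) (e : ℤ × List ℕ × Mono) : Mono × ℤ :=
  (msortBy (fun a b => Nat.ble a b) e.2.2.length (e.2.2.map (imgMask n e.2.1)), e.1)

/-- All permutations in the data are well formed. [this work] -/
def checkD (n : ℕ) (D : List (ℤ × List ℕ × Mono)) : Bool := D.all fun e => isPermList n e.2.1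

/-- Bundled data check: well-formed permutations and vanishing orbit-class sums. [this work] -/
def checkDZ (n : ℕ) (D : List (ℤ × List ℕ × Mono)) : Bool :=
  checkD n D && decide (normP (D.map fun e => (e.2.2, e.1)) = [])

/-- **The orbit-basis check**: data well formed, the relabelled data IS the normal form of `R = Q − M·Φ_n`, and all orbit-class sums of `R`
vanish. [this work] -/
def verifyOrbit (n M : ℕ) (C : List (ℤ × List Atom)) (D : List (ℤ × List ℕ × Mono)) : Bool :=
  ((checkT C && checkD n D) &&
    decide (D.map (recon n) = normP (termsPolyN n C ++ scaleP (-(M : ℤ)) (symEN n n fun i => 2 ^ (i : ℕ))))) &&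
    decide (normP (D.map fun e => (e.2.2, e.1)) = [])

section Sound

variable {n : ℕ}

/-- Relabelling the data does not change the symmetrised evaluation. [this work] -/
theorem evalSym_recon (β : Finset (Fin n) → ℝ) : ∀ D : List (ℤ × List ℕ × Mono), checkD n D = true →
    evalSym β (D.map (recon n)) = evalSym β (D.map fun e => (e.2.2, e.1))
  | [], _ => rfl
  | e :: D, hD => by
    rw [checkD, List.all_cons, Bool.and_eq_true] at hD
    obtain ⟨he, hD'⟩ := hD
    rw [List.map_cons, List.map_cons, evalSym_eq, evalSym_eq, List.map_cons, List.map_cons, List.sum_cons, List.sum_cons,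
      ← evalSym_eq, ← evalSym_eq, evalSym_recon β D hD']
    unfold recon
    rw [Msum_relabel he]

/-- **REFLECTION, ORBIT BASIS**: a successful `verifyOrbit` check proves `F(n+1)` with standard axioms. [this work] -/
theorem phiNonneg_of_verifyOrbit (n M : ℕ) (hM : 0 < M) (C : List (ℤ × List Atom)) (D : List (ℤ × List ℕ × Mono))
    (h : verifyOrbit (n + 1) M C D = true) : PrincipalCapBeta.PhiNonneg (n + 1) := by
  intro β h0 h1 huniv hsup
  rw [verifyOrbit, Bool.and_eq_true, Bool.and_eq_true, Bool.and_eq_true, decide_eq_true_eq, decide_eq_true_eq] at h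
  obtain ⟨⟨⟨hT, hD⟩, hRD⟩, hzero⟩ := h
  set R : Poly := termsPolyN (n + 1) C ++ scaleP (-(M : ℤ)) (symEN (n + 1) (n + 1) fun i => 2 ^ (i : ℕ)) with hR
  -- the symmetrised R vanishes
  have hR0 : evalSym β R = 0 := by
    rw [← evalSym_normP, ← hRD, evalSym_recon β D hD, ← evalSym_normP, hzero]
    simp [evalSym, evalP]
  -- feasibility of the relabelled valuations
  have hu : ∀ σ : Equiv.Perm (Fin (n + 1)), actV σ β univ = 1 := fun σ => by rw [actV_univ, huniv]
  -- pointwise value of R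
  have hRσ : ∀ σ : Equiv.Perm (Fin (n + 1)), evalP (val (actV σ β)) R =
      evalP (val (actV σ β)) (termsPoly (n + 1) C) - (M : ℝ) * PrincipalCapBeta.phiSet (n + 1) β := by
    intro σ
    rw [hR, evalP_append, evalP_scaleP, evalP_termsPolyN, evalP_symEN_singletons _ (hu σ), phiSet_actV]
    push_cast
    ring
  have hsum : evalSym β R = (∑ σ : Equiv.Perm (Fin (n + 1)), evalP (val (actV σ β)) (termsPoly (n + 1) C)) -
      ((Nat.factorial (n + 1) : ℕ) : ℝ) * ((M : ℝ) * PrincipalCapBeta.phiSet (n + 1) β) := by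
    unfold evalSym
    rw [Finset.sum_congr rfl fun σ _ => hRσ σ, Finset.sum_sub_distrib, Finset.sum_const, Finset.card_univ,
      Fintype.card_perm, Fintype.card_fin, nsmul_eq_mul]
  have hQ : 0 ≤ ∑ σ : Equiv.Perm (Fin (n + 1)), evalP (val (actV σ β)) (termsPoly (n + 1) C) :=
    Finset.sum_nonneg fun σ _ => termsPoly_nonneg (actV σ β) (fun B => h0 _) (fun B => h1 _) (hu σ)
      (actV_supermul σ β hsup) C hT
  have hfac : (0 : ℝ) < ((Nat.factorial (n + 1) : ℕ) : ℝ) := by exact_mod_cast Nat.factorial_pos (n + 1)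
  have hM' : (0 : ℝ) < (M : ℝ) := by exact_mod_cast hM
  have key : ((Nat.factorial (n + 1) : ℕ) : ℝ) * ((M : ℝ) * PrincipalCapBeta.phiSet (n + 1) β) =
      ∑ σ : Equiv.Perm (Fin (n + 1)), evalP (val (actV σ β)) (termsPoly (n + 1) C) := by
    linarith [hsum, hR0]
  have h3 : 0 ≤ (M : ℝ) * PrincipalCapBeta.phiSet (n + 1) β :=
    (mul_nonneg_iff_of_pos_left hfac).1 (key ▸ hQ)
  exact (mul_nonneg_iff_of_pos_left hM').1 h3


/-- **REFLECTION, ORBIT BASIS, IN PIECES** (so that each kernel evaluation stays small): the same conclusion from the five component checks,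
with the common normal form `RD` of `R = Q − M·Φ_n` supplied as data. [this work] -/
theorem phiNonneg_of_orbitPieces (n M : ℕ) (hM : 0 < M) (C : List (ℤ × List Atom)) (D : List (ℤ × List ℕ × Mono)) (RD : Poly)
    (hT : checkT C = true) (hD : checkD (n + 1) D = true)
    (hR : normP (termsPolyN (n + 1) C ++ scaleP (-(M : ℤ)) (symEN (n + 1) (n + 1) fun i => 2 ^ (i : ℕ))) = RD)
    (hrec : D.map (recon (n + 1)) = RD) (hz : normP (D.map fun e => (e.2.2, e.1)) = []) :
    PrincipalCapBeta.PhiNonneg (n + 1) := by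
  refine phiNonneg_of_verifyOrbit n M hM C D ?_
  rw [verifyOrbit, hT, hD, hR, hrec, hz]
  simp


/-- The same with the two data checks bundled into one Boolean. [this work] -/
theorem phiNonneg_of_orbitPieces' (n M : ℕ) (hM : 0 < M) (C : List (ℤ × List Atom)) (D : List (ℤ × List ℕ × Mono)) (RD : Poly)
    (hT : checkT C = true)
    (hDZ : checkDZ (n + 1) D = true)
    (hR : normP (termsPolyN (n + 1) C ++ scaleP (-(M : ℤ)) (symEN (n + 1) (n + 1) fun i => 2 ^ (i : ℕ))) = RD)
    (hrec : D.map (recon (n + 1)) = RD) :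
    PrincipalCapBeta.PhiNonneg (n + 1) := by
  rw [checkDZ, Bool.and_eq_true, decide_eq_true_eq] at hDZ
  exact phiNonneg_of_orbitPieces n M hM C D RD hT hDZ.1 hR hrec hDZ.2

end Sound

end PhiCert

end Summit.CriticalPhenomena.PercolationContinuityZ3.Theorems
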